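import Mathlib
import HarnessLib

/-!
# Crux `PoloidalLiouville` (stmt-NavierStokesRegularity-1222, wall W1), crux idea «steady-centre-sieve» (ns-idea-15 g5):
# ANALYTIC PRIMITIVES — a differentiable function with real-analytic derivative is real-analytic

Support file (Theorems-side helper, general calculus; seat ns-wall-eng-7 g5, cell ns-wall-extremal, W1 adjunct; `--supports
stmt-NavierStokesRegularity-1222 --as helper`).  Used to pass from the real-analytic pressure GRADIENT `∇p = ΔV − (V·∇)V` of a bounded
steady flow (velocity analytic by the tree's `IsSteadyNSSolution.analyticOnNhd_of_bounded`) to a real-analytic PRESSURE, which the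
card's rigidity conjectures C1/C1* take as a hypothesis — so that the reductions R2/R2* need no literature fact at all
(`ThreadingFluxCentreJetRigidityReductionSharp.lean`).

Let `E`, `F` be real normed spaces, `F` complete, `f : E → F` differentiable near `x₀` with `A = fderiv ℝ f` given near `x₀` by a
power series `A(x₀ + y) = Σₙ qₙ(y, …, y)`.  Then `f(x₀ + y) = f(x₀) + Σₙ qₙ(y, …, y) y / (n + 1)` near `x₀`: by the fundamental theorem
of calculus along the segment, `f(x₀ + y) − f(x₀) = ∫₀¹ A(x₀ + t y) y dt = ∫₀¹ Σₙ tⁿ qₙ(y,…,y) y dt`, and the series may be integrated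
termwise (dominated convergence, `Σ ‖qₙ‖ ‖y‖ⁿ⁺¹ < ∞` inside the radius).  The primitive series is Mathlib's
`FormalMultilinearSeries.unshift q (f x₀)` rescaled by `1/(n+1)` in degree `n + 1` (built inside the proof; no definition is added).

* `CentreJet.hasSum_primitive_of_fderiv` — the radial integration identity;
* `CentreJet.analyticAt_of_fderiv`, `CentreJet.analyticOnNhd_of_fderiv` — the analyticity statements.

Mathlib has the converse direction (`AnalyticAt.fderiv`, `HasFPowerSeriesOnBall.fderiv`) but not this one.  Standard real-analytic
function theory (Krantz–Parks, *A Primer of Real Analytic Functions*, 2nd ed. 2002, Ch. 1–2: power series may be integrated termwise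
inside the domain of convergence).  HONEST LABEL: elementary calculus; nothing about NS regularity, which is OPEN.
-/

-- the summit and its single problem share the name (D-0017 nested layout)
set_option linter.dupNamespace false

noncomputable section

open Set Filter MeasureTheory intervalIntegral
open scoped Topology ENNReal NNReal

namespace Summit.NavierStokesRegularity.NavierStokesRegularity.Theorems.PoloidalLiouville.CentreJet

section AnalyticPrimitive

variable {E : Type*} [NormedAddCommGroup E] [NormedSpace ℝ E]
  {F : Type*} [NormedAddCommGroup F] [NormedSpace ℝ F] [CompleteSpace F]

/-- **Radial integration of the derivative series.**  If `fderiv ℝ f` has the power series `q` on the ball `B(x₀, r)` and `f` is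
differentiable there, then for `‖y‖ < r`: `Σₙ qₙ(y,…,y) y / (n+1) = f(x₀ + y) − f(x₀)` (fundamental theorem of calculus on the
segment + termwise integration by dominated convergence).  -/
theorem hasSum_primitive_of_fderiv {f : E → F} {q : FormalMultilinearSeries ℝ E (E →L[ℝ] F)} {x₀ : E} {r : ℝ≥0∞}
    (hq : HasFPowerSeriesOnBall (fderiv ℝ f) q x₀ r) (hf : DifferentiableOn ℝ f (Metric.eball x₀ r))
    {y : E} (hy : y ∈ Metric.eball (0 : E) r) :
    HasSum (fun n : ℕ => ((n : ℝ) + 1)⁻¹ • q n (fun _ => y) y) (f (x₀ + y) - f x₀) := by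
  have hy' : (‖y‖₊ : ℝ≥0∞) < r := by
    have h := hy
    rw [Metric.mem_eball, edist_zero_right] at h
    exact h
  -- points of the segment lie in the ball
  have hseg : ∀ t : ℝ, t ∈ Icc (0 : ℝ) 1 → x₀ + t • y ∈ Metric.eball x₀ r := by
    intro t ht
    rw [Metric.mem_eball, edist_eq_enorm_sub, add_sub_cancel_left]
    refine lt_of_le_of_lt ?_ hy'
    rw [enorm_smul, show (‖y‖₊ : ℝ≥0∞) = ‖y‖ₑ from rfl]
    refine mul_le_of_le_one_left (by positivity) ?_
    rw [Real.enorm_eq_ofReal ht.1]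
    exact ENNReal.ofReal_le_one.2 ht.2
  have hball_open : IsOpen (Metric.eball x₀ r) := Metric.isOpen_eball
  -- (1) FTC along the segment: `∫₀¹ A(x₀ + t y) y dt = f(x₀ + y) − f(x₀)`
  have hderiv : ∀ t ∈ uIcc (0 : ℝ) 1, HasDerivAt (fun t : ℝ => f (x₀ + t • y)) (fderiv ℝ f (x₀ + t • y) y) t := by
    intro t ht
    rw [uIcc_of_le zero_le_one] at ht
    have hfd : HasFDerivAt f (fderiv ℝ f (x₀ + t • y)) (x₀ + t • y) :=
      (hf.differentiableAt (hball_open.mem_nhds (hseg t ht))).hasFDerivAt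
    have hl : HasDerivAt (fun t : ℝ => x₀ + t • y) y t := by
      simpa using ((hasDerivAt_id t).smul_const y).const_add x₀
    exact hfd.comp_hasDerivAt t hl
  have hAc : ContinuousOn (fun t : ℝ => fderiv ℝ f (x₀ + t • y) y) (uIcc (0 : ℝ) 1) := by
    rw [uIcc_of_le zero_le_one]
    have h1 : ContinuousOn (fun t : ℝ => fderiv ℝ f (x₀ + t • y)) (Icc (0 : ℝ) 1) :=
      hq.continuousOn.comp (by fun_prop) fun t ht => hseg t ht
    exact h1.clm_apply continuousOn_const
  have hFTC : ∫ t in (0 : ℝ)..1, fderiv ℝ f (x₀ + t • y) y = f (x₀ + y) - f x₀ := by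
    rw [integral_eq_sub_of_hasDerivAt hderiv (hAc.intervalIntegrable)]
    simp
  -- (2) the integrand as a series: `A(x₀ + t y) y = Σₙ tⁿ qₙ(y,…,y) y`
  have hlim : ∀ t ∈ Icc (0 : ℝ) 1, HasSum (fun n : ℕ => (t ^ n) • q n (fun _ => y) y) (fderiv ℝ f (x₀ + t • y) y) := by
    intro t ht
    have hty : t • y ∈ Metric.eball (0 : E) r := by
      have := hseg t ht
      rw [Metric.mem_eball, edist_eq_enorm_sub, add_sub_cancel_left] at this
      rwa [Metric.mem_eball, edist_zero_right]
    have h1 := hq.hasSum hty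
    have h2 : ∀ n : ℕ, q n (fun _ : Fin n => t • y) = t ^ n • q n (fun _ => y) := fun n => by
      rw [show (fun _ : Fin n => t • y) = fun i : Fin n => (fun _ : Fin n => t) i • (fun _ : Fin n => y) i from rfl,
        ContinuousMultilinearMap.map_smul_univ, Fin.prod_const]
    simp only [h2] at h1
    simpa using (ContinuousLinearMap.apply ℝ F y).hasSum h1
  -- (3) termwise integration (dominated convergence with the constant bound `‖qₙ‖ ‖y‖ⁿ ‖y‖`)
  have hsumq : Summable fun n : ℕ => ‖q n‖ * (‖y‖₊ : ℝ) ^ n := q.summable_norm_mul_pow (lt_of_lt_of_le hy' hq.r_le)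
  have hDC : HasSum (fun n : ℕ => ∫ t in (0 : ℝ)..1, (t ^ n) • q n (fun _ => y) y)
      (∫ t in (0 : ℝ)..1, fderiv ℝ f (x₀ + t • y) y) := by
    refine hasSum_integral_of_dominated_convergence (fun n _ => ‖q n‖ * ‖y‖ ^ n * ‖y‖)
      (fun n => (Continuous.aestronglyMeasurable (by fun_prop))) (fun n => ?_) ?_ ?_ ?_
    · refine Eventually.of_forall fun t ht => ?_
      rw [uIoc_of_le zero_le_one] at ht
      have ht1 : |t| ≤ 1 := abs_le.2 ⟨by linarith [ht.1], ht.2⟩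
      calc ‖t ^ n • q n (fun _ => y) y‖ = |t| ^ n * ‖q n (fun _ => y) y‖ := by
            rw [norm_smul, norm_pow, Real.norm_eq_abs]
        _ ≤ 1 * (‖q n‖ * ‖y‖ ^ n * ‖y‖) := by
            refine mul_le_mul (pow_le_one₀ (abs_nonneg t) ht1) ?_ (norm_nonneg _) zero_le_one
            refine (ContinuousLinearMap.le_opNorm _ _).trans (mul_le_mul_of_nonneg_right ?_ (norm_nonneg _))
            simpa [Fin.prod_const] using (q n).le_opNorm (fun _ : Fin n => y)
        _ = ‖q n‖ * ‖y‖ ^ n * ‖y‖ := one_mul _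
    · exact Eventually.of_forall fun t _ => (hsumq.mul_right ‖y‖).congr fun n => by simp
    · exact intervalIntegrable_const
    · refine Eventually.of_forall fun t ht => hlim t ?_
      rw [uIoc_of_le zero_le_one] at ht
      exact ⟨ht.1.le, ht.2⟩
  -- (4) `∫₀¹ tⁿ dt = 1/(n+1)`
  have hI : ∀ n : ℕ, ∫ t in (0 : ℝ)..1, (t ^ n) • q n (fun _ => y) y = ((n : ℝ) + 1)⁻¹ • q n (fun _ => y) y := fun n => by
    rw [intervalIntegral.integral_smul_const, integral_pow]
    simp [one_div]
  simp only [hI, hFTC] at hDC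
  exact hDC

/-- **A function with real-analytic derivative is real-analytic** (pointwise form): if `f` is differentiable near `x₀` and
`fderiv ℝ f` is analytic at `x₀`, then `f` is analytic at `x₀` — with the explicit power series `P₀ = f(x₀)`,
`Pₙ₊₁(y₀,…,yₙ) = qₙ(y₀,…,yₙ₋₁) yₙ / (n+1)` (Mathlib's `unshift`, rescaled), whose radius is at least that of `q`. -/
theorem analyticAt_of_fderiv {f : E → F} {x₀ : E} (hA : AnalyticAt ℝ (fderiv ℝ f) x₀)
    (hf : ∀ᶠ y in 𝓝 x₀, DifferentiableAt ℝ f y) : AnalyticAt ℝ f x₀ := by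
  obtain ⟨q, r₀, hq₀⟩ := hA
  obtain ⟨ε, hε, hεd⟩ := EMetric.mem_nhds_iff.1 hf
  set r : ℝ≥0∞ := min r₀ ε with hr
  have hq : HasFPowerSeriesOnBall (fderiv ℝ f) q x₀ r := hq₀.mono (lt_min hq₀.r_pos hε) (min_le_left _ _)
  have hfd : DifferentiableOn ℝ f (Metric.eball x₀ r) := fun y hy =>
    (hεd (Metric.eball_subset_eball (min_le_right _ _) hy)).differentiableWithinAt
  -- the primitive series: `unshift` rescaled by `1/(n+1)` in degree `n + 1`
  let P : FormalMultilinearSeries ℝ E F := fun n =>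
    match n with
    | 0 => q.unshift (f x₀) 0
    | n + 1 => ((n : ℝ) + 1)⁻¹ • q.unshift (f x₀) (n + 1)
  have hP0 : ∀ v : Fin 0 → E, P 0 v = f x₀ := fun v => by
    simp [P, FormalMultilinearSeries.unshift]
  have hPs : ∀ (n : ℕ) (y : E), P (n + 1) (fun _ => y) = ((n : ℝ) + 1)⁻¹ • q n (fun _ => y) y := fun n y => by
    have h : Fin.init (fun _ : Fin (n + 1) => y) = fun _ : Fin n => y := rfl
    simp [P, FormalMultilinearSeries.unshift, h]
  have hPnorm : ∀ n : ℕ, ‖P (n + 1)‖ = ((n : ℝ) + 1)⁻¹ * ‖q n‖ := fun n => by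
    have hn : (0 : ℝ) ≤ ((n : ℝ) + 1)⁻¹ := by positivity
    simp only [P, FormalMultilinearSeries.unshift, norm_smul, Real.norm_eq_abs, abs_of_nonneg hn,
      LinearIsometryEquiv.norm_map]
  -- radius
  have hrad : q.radius ≤ P.radius := by
    refine ENNReal.le_of_forall_nnreal_lt fun r' hr' => ?_
    obtain ⟨C, hC0, hC⟩ := q.norm_mul_pow_le_of_lt_radius hr'
    refine P.le_radius_of_bound (max ‖P 0‖ (C * r')) fun n => ?_
    rcases n with _ | n
    · simp
    · rw [hPnorm, pow_succ]
      have hn1 : ((n : ℝ) + 1)⁻¹ ≤ 1 := inv_le_one_of_one_le₀ (by simp)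
      calc ((n : ℝ) + 1)⁻¹ * ‖q n‖ * ((r' : ℝ) ^ n * r') = ((n : ℝ) + 1)⁻¹ * ((‖q n‖ * (r' : ℝ) ^ n) * r') := by ring
        _ ≤ 1 * (C * r') := by
            refine mul_le_mul hn1 (mul_le_mul_of_nonneg_right (hC n) r'.coe_nonneg) (by positivity) zero_le_one
        _ ≤ max ‖P 0‖ (C * r') := by rw [one_mul]; exact le_max_right _ _
  -- the power series of `f`
  have hfP : HasFPowerSeriesOnBall f P x₀ r :=
    { r_le := hq.r_le.trans hrad
      r_pos := hq.r_pos
      hasSum := by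
        intro y hy
        have h := hasSum_primitive_of_fderiv hq hfd hy
        rw [← hasSum_nat_add_iff' 1]
        simpa [hPs, hP0, sub_eq_add_neg] using h }
  exact ⟨P, r, hfP⟩

/-- **A function with real-analytic derivative is real-analytic** (open-set form): if `f` is differentiable on an open set `U` and
`fderiv ℝ f` is real-analytic on `U`, then `f` is real-analytic on `U`. -/
theorem analyticOnNhd_of_fderiv {f : E → F} {U : Set E} (hU : IsOpen U) (hf : DifferentiableOn ℝ f U)
    (hA : AnalyticOnNhd ℝ (fderiv ℝ f) U) : AnalyticOnNhd ℝ f U := fun x hx =>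
  analyticAt_of_fderiv (hA x hx) (by
    filter_upwards [hU.mem_nhds hx] with y hy
    exact hf.differentiableAt (hU.mem_nhds hy))

end AnalyticPrimitive

end Summit.NavierStokesRegularity.NavierStokesRegularity.Theorems.PoloidalLiouville.CentreJet

end
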